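import Summits.HodgeConjecture.CorCM.MultiFieldWeilTwinsSextics
import Summits.HodgeConjecture.CorCM.MultiFieldWeilTwinGroupBlock
import Summits.HodgeConjecture.CorCM.MultiFieldWeilQuadraticSexticClosures
import HarnessLib

/-!
# MULTI-FIELD WEIL ENGINE — THE TWIN-PAIRS GROUP BLOCK: in a uniform family, a group of sextic slots through one imaginary quadratic field `k` containing ANY NUMBER of pairs
# of slots with ISOMORPHIC fields (two types of one field each) and otherwise pairwise non-isomorphic fields, with any CM elliptic curves through `k` — the Hodge conjecture for
# every product of copies, given ONLY Markman's fourfold theorem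

Cell `pub-hodgecm2` (COR-CM), seat b30 gen 37 (2026-08-25); count-neutral own lane MULTI-FIELD WEIL ENGINE (stem `MultiFieldWeil*`), the family dress of T3b
`CorCM/MultiFieldWeilTwinsSextics.lean` in the pattern of T5 `CorCM/MultiFieldWeilTwinGroupBlock.lean` (ONE pair).  Theorems only; no definition, no named fact, no `sorry`.
HONEST FRAMING: conditional ONLY on `Markman2025_weilClasses_algebraic_abelianFourfold`; `HC_CM` is NOT proved and not asserted.

**`hodgeConjectureFor_prod_twinPairsGroupBlock_of_isEmpty_ringHom`** — `A_i ⊨ (K_i; Φ_i)` simple; sextic slots `u j`, `u' j` (`j < s`) with `K_{u' j} ≃ K_{u j} ∋ i_j(k)` carrying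
NON-ISOGENOUS varieties (two types of one field each; `Hom(K_{u j}, K_{u j₀}) = ∅` for `j₀ ≠ j`), and `e : Fin r → I` further sextic slots with `K_{e m} ∋ i_m(k)`,
`Hom(K_{e m}, K_{u j}) = ∅`, `Hom(K_{e m}, K_{e m₀}) = ∅` (`m₀ ≠ m`); a product of copies every member of which is some `A_{u j}`, `A_{u' j}`, `A_{e m}`, or a CM elliptic curve whose
field embeds in some `K_{u j}` or `K_{e m}`.  Then the Hodge conjecture holds for it: every such curve is isogenous to the CM curve `E ⊨ (k; {τ})`, `A_{u' j}` is re-read over `K_{u j}`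
(`IsCMTypeRealisation.transport`), and the product is isogenous to a product of copies of the concrete family over the slots `(Fin s ⊕ Fin s) ⊕ Fin r ≃ Fin (s + s + r)` with fields
`Option.elim · k (Sum.elim (K ∘ u) (K ∘ e))` and the swap involution, settled by T3b `hodgeConjectureFor_biproduct_comp_of_simpleSexticTwinPairs_of_isEmpty_ringHom`.  PURPOSE: the
block of a k-group with SEVERAL isomorphic pairs in the classes-per-field theorems (`CorCM/MultiFieldWeilTwoPerField*` allow ONE doubled field per k-group; the port dropping
(A₃)/(b₂′) «doubled fields do not share k» to «non-isomorphic doubled fields» is the sequel); dominated form.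
[cite: Markman2025SurveySecant, Thm. 1.2] [cite: Shimura1998, §6.1 Corollary of Theorem 2 (p. 41), §8.2 Prop. 26, §18.2 Lemma (i)] [cite: Lang2002, VI §1 Thm. 1.1 and Cor. 1.6]
[cite: MumfordAV1970, §19 Thm. 1 and p. 169]

## References
* [Markman2025SurveySecant] E. Markman, arXiv:2509.23403, Thm. 1.2.  [Shimura1998] G. Shimura, CM book, §6.1, §8.2, §18.2.  [Lang2002] S. Lang, *Algebra*, VI §1.  [MumfordAV1970]
  D. Mumford, *Abelian Varieties*, §19.
-/

noncomputable section

open CategoryTheory CategoryTheory.Limits NumberField IntermediateField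

namespace Summit.HodgeConjecture.CorCM.MultiFieldWeil

open Finset
open Literature.AlgebraicGeometry Literature.AlgebraicGeometry.Motives Literature.AlgebraicGeometry.HodgeTheory
open Literature.AlgebraicGeometry.ComplexMultiplication (IsCMTypeRealisation)
open Literature.AlgebraicTopology.SingularHomology
open Literature.NumberTheory.ComplexMultiplication
open Literature.AlgebraicGeometry.Pohlmann1968

open scoped Classical

section TwinPairsGroup

variable {I : Type} {K : I → Type} [fK : ∀ i, Field (K i)] [nK : ∀ i, NumberField (K i)] [cK : ∀ i, IsCMField (K i)]
  {Φ : ∀ i, CMType (K i)} {A : I → AbelianVariety ℂ} {ι : ∀ i, 𝓞 (K i) →+* End (A i)} {θ : ∀ i, K i →+* Module.End ℂ (complexBetti (A i).X 1)}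

/-! ## §1 Enumerated form -/

/-- **THE TWIN-PAIRS GROUP BLOCK.**  See the module docstring.  `HC_CM` is NOT asserted. [cite: Markman2025SurveySecant, Thm. 1.2] [cite: Shimura1998, §6.1 Corollary of Theorem 2,
§18.2 Lemma (i)] [cite: MumfordAV1970, §19 Thm. 1 and p. 169] -/
theorem hodgeConjectureFor_prod_twinPairsGroupBlock_of_isEmpty_ringHom (hW4 : Markman2025_weilClasses_algebraic_abelianFourfold)
    (hA : ∀ i, IsCMTypeRealisation (Φ i) (A i) (ι i) (θ i)) (hS : ∀ i, (A i).IsSimple)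
    {s : ℕ} (u u' : Fin s → I) (h6u : ∀ j, Module.finrank ℚ (K (u j)) = 6) (ε : ∀ j, K (u' j) ≃+* K (u j))
    (hni : ∀ j, ¬ AbelianVariety.IsIsogenous (A (u j)) (A (u' j)))
    {r : ℕ} (e : Fin r → I) (h6 : ∀ m, Module.finrank ℚ (K (e m)) = 6)
    {k : Type} [fk : Field k] [nk : NumberField k] [ck : IsCMField k] (h2 : Module.finrank ℚ k = 2) (iu : ∀ j, k →+* K (u j)) (im : ∀ m, k →+* K (e m))
    (hisoU : ∀ j₀ j : Fin s, j₀ ≠ j → IsEmpty (K (u j) →+* K (u j₀))) (hisoUE : ∀ (j : Fin s) (m : Fin r), IsEmpty (K (e m) →+* K (u j)))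
    (hiso : ∀ m₀ m : Fin r, m₀ ≠ m → IsEmpty (K (e m) →+* K (e m₀)))
    {M : ℕ} (ρ : Fin M → I)
    (hρ : ∀ l, (Module.finrank ℚ (K (ρ l)) = 2 ∧ ((∃ j, Nonempty (K (ρ l) →+* K (u j))) ∨ ∃ m, Nonempty (K (ρ l) →+* K (e m)))) ∨
      (∃ j, ρ l = u j) ∨ (∃ j, ρ l = u' j) ∨ ∃ m, ρ l = e m) :
    HodgeConjectureFor (⨁ fun l => A (ρ l)).dim (⨁ fun l => A (ρ l)).X := by
  -- the CM elliptic curve of `k`; every curve member is isogenous to it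
  obtain ⟨τ⟩ : Nonempty (k →+* ℂ) := inferInstance
  obtain ⟨Ψ, E, ιE, θE, hE, hΨ⟩ := exists_cmCurve_iff_eq h2 τ
  have hcurve : ∀ l, (Module.finrank ℚ (K (ρ l)) = 2 ∧ ((∃ j, Nonempty (K (ρ l) →+* K (u j))) ∨ ∃ m, Nonempty (K (ρ l) →+* K (e m)))) →
      AbelianVariety.IsIsogenous (A (ρ l)) E := by
    rintro l ⟨h2l, ⟨j, ⟨g⟩⟩ | ⟨m, ⟨g⟩⟩⟩
    · obtain ⟨φ⟩ := WeilFibre.nonempty_algEquiv_of_finrank_eq_two (M := K (u j)) h2l h2 (by rw [h6u j]; decide) g.toRatAlgHom (iu j).toRatAlgHom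
      exact isIsogenous_of_ringEquiv h2l (hA (ρ l)) hE φ.symm.toRingEquiv
    · obtain ⟨φ⟩ := WeilFibre.nonempty_algEquiv_of_finrank_eq_two (M := K (e m)) h2l h2 (by rw [h6 m]; decide) g.toRatAlgHom (im m).toRatAlgHom
      exact isIsogenous_of_ringEquiv h2l (hA (ρ l)) hE φ.symm.toRingEquiv
  -- degrees and `Hom = ∅` in both directions
  have hfin_le : ∀ {i i' : I} (g : K i →+* K i'), Module.finrank ℚ (K i) ≤ Module.finrank ℚ (K i') := fun g =>
    LinearMap.finrank_le_finrank_of_injective (f := g.toRatAlgHom.toLinearMap) g.injective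
  have hsym : ∀ {i i' : I}, Module.finrank ℚ (K i) = Module.finrank ℚ (K i') → IsEmpty (K i →+* K i') → IsEmpty (K i' →+* K i) := by
    intro i i' hfin hK
    exact ⟨fun g => by
      have hinj : Function.Injective g.toRatAlgHom.toLinearMap := g.injective
      have hsurj : Function.Surjective g.toRatAlgHom.toLinearMap := (LinearMap.injective_iff_surjective_of_finrank_eq_finrank hfin.symm).1 hinj
      exact hK.false (AlgEquiv.ofBijective g.toRatAlgHom ⟨hinj, hsurj⟩).symm.toRingEquiv.toRingHom⟩
  -- the labels `Fin s ⊕ Fin r` (one per field) and the slots `(Fin s ⊕ Fin s) ⊕ Fin r ≃ Fin (s + s + r)` (two per doubled field)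
  let L := Fin s ⊕ Fin r
  let S := (Fin s ⊕ Fin s) ⊕ Fin r
  let KS : L → Type := Sum.elim (fun j => K (u j)) (fun m => K (e m))
  let Kf : Option L → Type := fun o => o.elim k KS
  letI instKS : ∀ x : L, Field (KS x) := fun x => @Sum.rec (Fin s) (Fin r) (fun x => Field (KS x)) (fun j => fK (u j)) (fun m => fK (e m)) x
  letI instF : ∀ o, Field (Kf o) := fun o => @Option.rec L (fun o => Field (Kf o)) fk (fun x => instKS x) o
  letI instNS : ∀ x : L, NumberField (KS x) := fun x => @Sum.rec (Fin s) (Fin r) (fun x => NumberField (KS x)) (fun j => nK (u j)) (fun m => nK (e m)) x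
  letI instN : ∀ o, NumberField (Kf o) := fun o => @Option.rec L (fun o => NumberField (Kf o)) nk (fun x => instNS x) o
  haveI instCS : ∀ x : L, IsCMField (KS x) := fun x => @Sum.rec (Fin s) (Fin r) (fun x => IsCMField (KS x)) (fun j => cK (u j)) (fun m => cK (e m)) x
  haveI instC : ∀ o, IsCMField (Kf o) := fun o => @Option.rec L (fun o => IsCMField (Kf o)) ck (fun x => instCS x) o
  let iK : ∀ o, Kf none →+* Kf o := fun o =>
    @Option.rec L (fun o => Kf none →+* Kf o) (RingHom.id k) (fun x => @Sum.rec (Fin s) (Fin r) (fun x => Kf none →+* Kf (some x)) iu im x) o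
  have hKS : ∀ a b : L, a ≠ b → IsEmpty (KS a →+* KS b) := by
    rintro (j | m) (j' | m') hne
    · exact hisoU j' j fun h => hne (by rw [h])
    · exact hsym ((h6 m').trans (h6u j).symm) (hisoUE j m')
    · exact hisoUE j' m
    · exact hiso m' m fun h => hne (by rw [h])
  have h6S : ∀ x : L, Module.finrank ℚ (KS x) = 6 := by
    rintro (j | m)
    · exact h6u j
    · exact h6 m
  obtain ⟨σR⟩ : Nonempty (Fin (s + s + r) ≃ S) := ⟨finSumFinEquiv.symm.trans (Equiv.sumCongr finSumFinEquiv.symm (Equiv.refl (Fin r)))⟩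
  let lab : S → L := Sum.map (Sum.elim id id) id
  let flipS : S → S := Sum.map Sum.swap id
  have hflip2 : ∀ x : S, flipS (flipS x) = x := by rintro ((j | j) | m) <;> rfl
  have hlabflip : ∀ x : S, lab (flipS x) = lab x := by rintro ((j | j) | m) <;> rfl
  have hlab_eq : ∀ x y : S, lab x = lab y → x = y ∨ x = flipS y := by
    rintro ((j | j) | m) ((j' | j') | m') h <;> first
      | (cases h; exact Or.inl rfl) | (cases h; exact Or.inr rfl) | cases h
  let is : Fin (s + s + r) → Option L := fun m => some (lab (σR m))
  let tw : Fin (s + s + r) → Fin (s + s + r) := fun m => σR.symm (flipS (σR m))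
  have hσtw : ∀ m, σR (tw m) = flipS (σR m) := fun m => Equiv.apply_symm_apply _ _
  have htw : ∀ m, tw (tw m) = m := fun m => σR.injective (by rw [hσtw, hσtw, hflip2])
  have hι : ∀ m, is (tw m) = is m := fun m => by
    show some (lab (σR (tw m))) = some (lab (σR m))
    rw [hσtw, hlabflip]
  -- the concrete family over the slots: `A (u j)`, `A (u' j)` re-read over `K (u j)`, `A (e m)`
  let TS : S → AbelianVariety ℂ := Sum.elim (Sum.elim (fun j => A (u j)) (fun j => A (u' j))) (fun m => A (e m))
  let ΦS : ∀ x : S, CMType (Kf (some (lab x))) := fun x =>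
    @Sum.rec _ _ (fun x => CMType (Kf (some (lab x))))
      (fun y => @Sum.rec _ _ (fun y => CMType (Kf (some (lab (Sum.inl y))))) (fun j => Φ (u j))
        (fun j => Literature.NumberTheory.Automorphic.PicardCM.CMCode.cmTypeMap (ε j) (Φ (u' j))) y)
      (fun m => Φ (e m)) x
  let ιS : ∀ x : S, 𝓞 (Kf (some (lab x))) →+* End (TS x) := fun x =>
    @Sum.rec _ _ (fun x => 𝓞 (Kf (some (lab x))) →+* End (TS x))
      (fun y => @Sum.rec _ _ (fun y => 𝓞 (Kf (some (lab (Sum.inl y)))) →+* End (TS (Sum.inl y))) (fun j => ι (u j))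
        (fun j => (ι (u' j)).comp (RingOfIntegers.mapRingEquiv (ε j).symm).toRingHom) y)
      (fun m => ι (e m)) x
  let θS : ∀ x : S, Kf (some (lab x)) →+* Module.End ℂ (complexBetti (TS x).X 1) := fun x =>
    @Sum.rec _ _ (fun x => Kf (some (lab x)) →+* Module.End ℂ (complexBetti (TS x).X 1))
      (fun y => @Sum.rec _ _ (fun y => Kf (some (lab (Sum.inl y))) →+* Module.End ℂ (complexBetti (TS (Sum.inl y)).X 1)) (fun j => θ (u j))
        (fun j => (θ (u' j)).comp (ε j).symm.toRingHom) y)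
      (fun m => θ (e m)) x
  have hTS : ∀ x : S, IsCMTypeRealisation (ΦS x) (TS x) (ιS x) (θS x) := by
    rintro ((j | j) | m)
    · exact hA (u j)
    · exact (hA (u' j)).transport (ε j)
    · exact hA (e m)
  have hSS : ∀ x : S, (TS x).IsSimple := by
    rintro ((j | j) | m)
    · exact hS (u j)
    · exact hS (u' j)
    · exact hS (e m)
  let T : Fin (s + s + r) → AbelianVariety ℂ := fun m => TS (σR m)
  obtain ⟨Φ', ι', θ', hA', h0, -⟩ := exists_realisations_cons (Kf := Kf) (i₀ := none) (is := is) (T := T) (ΦT := fun m => ΦS (σR m)) (ιT := fun m => ιS (σR m))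
    (θT := fun m => θS (σR m)) (Ψ := Ψ) (E := E) (ιE := ιE) (θE := θE) hE fun m => hTS (σR m)
  have hΨ' : ∀ σ : Kf none →+* ℂ, σ ∈ (Φ' 0).1 ↔ σ = τ := by rw [h0]; exact hΨ
  -- the hypotheses of T3b on the concrete family
  have h6' : ∀ m : Fin (s + s + r), Module.finrank ℚ (Kf (is m)) = 6 := fun m => h6S (lab (σR m))
  have hS' : ∀ m : Fin (s + s + r), ((Fin.cons E T : Fin (s + s + r + 1) → AbelianVariety ℂ) m.succ).IsSimple := fun m => hSS (σR m)
  have hni' : ∀ m : Fin (s + s + r), tw m ≠ m →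
      ¬ AbelianVariety.IsIsogenous ((Fin.cons E T : Fin (s + s + r + 1) → AbelianVariety ℂ) m.succ) ((Fin.cons E T : Fin (s + s + r + 1) → AbelianVariety ℂ) (tw m).succ) := by
    intro m htm
    show ¬ AbelianVariety.IsIsogenous (TS (σR m)) (TS (σR (tw m)))
    rw [hσtw]
    rcases hx : σR m with ((j | j) | m')
    · exact hni j
    · exact fun h => hni j h.symm'
    · exact absurd (σR.injective (by rw [hσtw, hx]; rfl)) htm
  have hiso' : ∀ m₀ m : Fin (s + s + r), m₀ ≠ m → tw m₀ ≠ m → IsEmpty (Kf (is m) →+* Kf (is m₀)) := by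
    intro m₀ m h₁ h₂
    have hl : lab (σR m) ≠ lab (σR m₀) := by
      intro hl
      rcases hlab_eq _ _ hl with h | h
      · exact h₁ (σR.injective h).symm
      · exact h₂ (σR.injective (by rw [hσtw]; exact h.symm))
    exact hKS _ _ hl
  -- the slot map
  let slot : I → Fin (s + s + r + 1) := fun x =>
    if h : ∃ j, x = u j then (σR.symm (Sum.inl (Sum.inl (Classical.choose h)))).succ
    else if h' : ∃ j, x = u' j then (σR.symm (Sum.inl (Sum.inr (Classical.choose h')))).succ
    else if h'' : ∃ m, x = e m then (σR.symm (Sum.inr (Classical.choose h''))).succ else 0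
  have hV : ∀ x : S, (Fin.cons E T : Fin (s + s + r + 1) → AbelianVariety ℂ) (σR.symm x).succ = TS x := fun x => by
    show TS (σR (σR.symm x)) = TS x
    rw [Equiv.apply_symm_apply]
  have hσ : ∀ l, AbelianVariety.IsIsogenous (A (ρ l)) ((Fin.cons E T : Fin (s + s + r + 1) → AbelianVariety ℂ) (slot (ρ l))) := by
    intro l
    by_cases h : ∃ j, ρ l = u j
    · have hs : slot (ρ l) = (σR.symm (Sum.inl (Sum.inl (Classical.choose h)))).succ := by simp only [slot, dif_pos h]
      rw [hs, hV]
      show AbelianVariety.IsIsogenous (A (ρ l)) (A (u (Classical.choose h)))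
      rw [← Classical.choose_spec h]
      exact AbelianVariety.IsIsogenous.refl _
    by_cases h' : ∃ j, ρ l = u' j
    · have hs : slot (ρ l) = (σR.symm (Sum.inl (Sum.inr (Classical.choose h')))).succ := by simp only [slot, dif_neg h, dif_pos h']
      rw [hs, hV]
      show AbelianVariety.IsIsogenous (A (ρ l)) (A (u' (Classical.choose h')))
      rw [← Classical.choose_spec h']
      exact AbelianVariety.IsIsogenous.refl _
    by_cases h'' : ∃ m, ρ l = e m
    · have hs : slot (ρ l) = (σR.symm (Sum.inr (Classical.choose h''))).succ := by simp only [slot, dif_neg h, dif_neg h', dif_pos h'']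
      rw [hs, hV]
      show AbelianVariety.IsIsogenous (A (ρ l)) (A (e (Classical.choose h'')))
      rw [← Classical.choose_spec h'']
      exact AbelianVariety.IsIsogenous.refl _
    have hs : slot (ρ l) = 0 := by simp only [slot, dif_neg h, dif_neg h', dif_neg h'']
    rw [hs]
    exact hcurve l ((hρ l).resolve_right fun hh => hh.elim h fun hh' => hh'.elim h' h'')
  have hisoV : AbelianVariety.IsIsogenous (⨁ fun l => A (ρ l)) (⨁ fun l => (Fin.cons E T : Fin (s + s + r + 1) → AbelianVariety ℂ) (slot (ρ l))) :=
    AbelianVariety.IsIsogenous.biproduct hσ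
  refine Domination.hodgeConjectureFor_of_avDominatedBy ?_ (Domination.AVDominatedBy.of_isIsogenous hisoV (Domination.AVDominatedBy.refl _))
  exact hodgeConjectureFor_biproduct_comp_of_simpleSexticTwinPairs_of_isEmpty_ringHom (Kf := Kf) (i₀ := none) (is := is) hW4 (fun l => slot (ρ l)) h2 h6' iK hA' hΨ'
    hS' tw htw hι hni' hiso'

/-- **Dominated form of the twin-pairs group block.** [cite: Markman2025SurveySecant, Thm. 1.2] [cite: MumfordAV1970, §19 Thm. 1 and p. 169] -/
theorem hodgeConjectureFor_of_avDominatedBy_prod_twinPairsGroupBlock_of_isEmpty_ringHom (hW4 : Markman2025_weilClasses_algebraic_abelianFourfold)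
    (hA : ∀ i, IsCMTypeRealisation (Φ i) (A i) (ι i) (θ i)) (hS : ∀ i, (A i).IsSimple)
    {s : ℕ} (u u' : Fin s → I) (h6u : ∀ j, Module.finrank ℚ (K (u j)) = 6) (ε : ∀ j, K (u' j) ≃+* K (u j))
    (hni : ∀ j, ¬ AbelianVariety.IsIsogenous (A (u j)) (A (u' j)))
    {r : ℕ} (e : Fin r → I) (h6 : ∀ m, Module.finrank ℚ (K (e m)) = 6)
    {k : Type} [Field k] [NumberField k] [IsCMField k] (h2 : Module.finrank ℚ k = 2) (iu : ∀ j, k →+* K (u j)) (im : ∀ m, k →+* K (e m))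
    (hisoU : ∀ j₀ j : Fin s, j₀ ≠ j → IsEmpty (K (u j) →+* K (u j₀))) (hisoUE : ∀ (j : Fin s) (m : Fin r), IsEmpty (K (e m) →+* K (u j)))
    (hiso : ∀ m₀ m : Fin r, m₀ ≠ m → IsEmpty (K (e m) →+* K (e m₀)))
    {M : ℕ} (ρ : Fin M → I)
    (hρ : ∀ l, (Module.finrank ℚ (K (ρ l)) = 2 ∧ ((∃ j, Nonempty (K (ρ l) →+* K (u j))) ∨ ∃ m, Nonempty (K (ρ l) →+* K (e m)))) ∨
      (∃ j, ρ l = u j) ∨ (∃ j, ρ l = u' j) ∨ ∃ m, ρ l = e m)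
    {X : AbelianVariety ℂ} (hX : Domination.AVDominatedBy X (⨁ fun l => A (ρ l))) : HodgeConjectureFor X.dim X.X :=
  Domination.hodgeConjectureFor_of_avDominatedBy
    (hodgeConjectureFor_prod_twinPairsGroupBlock_of_isEmpty_ringHom hW4 hA hS u u' h6u ε hni e h6 h2 iu im hisoU hisoUE hiso ρ hρ) hX

/-! ## §2 Relational form: a k-group with AT MOST TWO slots per field -/

/-- **THE TWIN-PAIRS GROUP BLOCK, RELATIONAL FORM.**  `G` a finite set of SEXTIC slots all receiving the imaginary quadratic field `k`, with AT MOST TWO slots per field inside `G`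
(`#{t' ∈ G | K_{t'} ≃ K_t} ≤ 2`) and pairwise NON-ISOGENOUS (simple) varieties; a product of copies every member of which lies in `G` or is a CM elliptic curve whose field embeds
in some `K_t`, `t ∈ G`.  Then the Hodge conjecture holds for it, GIVEN ONLY Markman's fourfold theorem: the doubled slots are paired off (partner unique by the count, oriented by an
enumeration of `G`), ring homomorphisms between sextic fields are isomorphisms (`nonempty_ringEquiv_of_ringHom_of_finrank_eq`), and §1 applies.  This is the form the k-group branch
of the classes-per-field theorems consumes (`CorCM/MultiFieldWeilTwoPerFieldFamilies.lean` with (A₃) dropped — the sequel).  `HC_CM` is NOT asserted.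
[cite: Markman2025SurveySecant, Thm. 1.2] [cite: Shimura1998, §6.1 Corollary of Theorem 2, §18.2 Lemma (i)] [cite: MumfordAV1970, §19 Thm. 1 and p. 169] -/
theorem hodgeConjectureFor_prod_twinPairsGroupBlock_of_card_le_two (hW4 : Markman2025_weilClasses_algebraic_abelianFourfold)
    (hA : ∀ i, IsCMTypeRealisation (Φ i) (A i) (ι i) (θ i)) (hS : ∀ i, (A i).IsSimple)
    (G : Finset I) (h6 : ∀ t ∈ G, Module.finrank ℚ (K t) = 6)
    {k : Type} [Field k] [NumberField k] [IsCMField k] (h2 : Module.finrank ℚ k = 2) (iG : ∀ t ∈ G, Nonempty (k →+* K t))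
    (h2G : ∀ t ∈ G, (G.filter fun t' => Nonempty (K t' ≃+* K t)).card ≤ 2)
    (hN : ∀ t ∈ G, ∀ t' ∈ G, t ≠ t' → ¬ AbelianVariety.IsIsogenous (A t) (A t'))
    {M : ℕ} (ρ : Fin M → I) (hρ : ∀ l, (Module.finrank ℚ (K (ρ l)) = 2 ∧ ∃ t ∈ G, Nonempty (K (ρ l) →+* K t)) ∨ ρ l ∈ G) :
    HodgeConjectureFor (⨁ fun l => A (ρ l)).dim (⨁ fun l => A (ρ l)).X := by
  -- isomorphic fields inside `G`: every ring homomorphism between sextic fields is an isomorphism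
  let Iso : I → I → Prop := fun t t' => Nonempty (K t' ≃+* K t)
  have hIso_of_hom : ∀ t ∈ G, ∀ t' ∈ G, (K t' →+* K t) → Iso t t' := fun t ht t' ht' g =>
    nonempty_ringEquiv_of_ringHom_of_finrank_eq g ((h6 t' ht').trans (h6 t ht).symm)
  have hIso_symm : ∀ t t', Iso t t' → Iso t' t := fun t t' ⟨ε⟩ => ⟨ε.symm⟩
  -- at most two per field: two slots isomorphic to `K t` besides `t` coincide
  have huniq : ∀ t ∈ G, ∀ t₁ ∈ G, ∀ t₂ ∈ G, t₁ ≠ t → t₂ ≠ t → Iso t t₁ → Iso t t₂ → t₁ = t₂ := by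
    intro t ht t₁ ht₁ t₂ ht₂ h₁ h₂ hi₁ hi₂
    by_contra h12
    have hsub : ({t, t₁, t₂} : Finset I) ⊆ G.filter fun t' => Iso t t' := by
      intro x hx
      simp only [Finset.mem_insert, Finset.mem_singleton] at hx
      rw [Finset.mem_filter]
      rcases hx with rfl | rfl | rfl
      · exact ⟨ht, ⟨RingEquiv.refl _⟩⟩
      · exact ⟨ht₁, hi₁⟩
      · exact ⟨ht₂, hi₂⟩
    have hcard : ({t, t₁, t₂} : Finset I).card = 3 := by
      rw [Finset.card_insert_of_notMem, Finset.card_insert_of_notMem (by simpa using h12), Finset.card_singleton]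
      simp only [Finset.mem_insert, Finset.mem_singleton, not_or]
      exact ⟨Ne.symm h₁, Ne.symm h₂⟩
    have := (Finset.card_le_card hsub).trans (h2G t ht)
    omega
  -- the doubled slots and their partners
  let D : Finset I := G.filter fun t => ∃ t' ∈ G, t' ≠ t ∧ Iso t t'
  have hDmem : ∀ t, t ∈ D ↔ t ∈ G ∧ ∃ t' ∈ G, t' ≠ t ∧ Iso t t' := fun t => Finset.mem_filter
  have hpx : ∀ t, ∃ t', t ∈ D → t' ∈ G ∧ t' ≠ t ∧ Iso t t' := fun t => by
    by_cases h : t ∈ D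
    · obtain ⟨-, t', ht', hne, hiso⟩ := (hDmem t).1 h
      exact ⟨t', fun _ => ⟨ht', hne, hiso⟩⟩
    · exact ⟨t, fun h' => absurd h' h⟩
  choose p hp using hpx
  have hDG : ∀ t ∈ D, t ∈ G := fun t ht => ((hDmem t).1 ht).1
  have hpG : ∀ t ∈ D, p t ∈ G := fun t ht => (hp t ht).1
  have hpne : ∀ t ∈ D, p t ≠ t := fun t ht => (hp t ht).2.1
  have hpiso : ∀ t ∈ D, Iso t (p t) := fun t ht => (hp t ht).2.2
  have hpD : ∀ t ∈ D, p t ∈ D := fun t ht => (hDmem _).2 ⟨hpG t ht, t, hDG t ht, (hpne t ht).symm, hIso_symm _ _ (hpiso t ht)⟩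
  have hp_uniq : ∀ t ∈ D, ∀ t' ∈ G, t' ≠ t → Iso t t' → t' = p t := fun t ht t' ht' hne hiso =>
    huniq t (hDG t ht) t' ht' (p t) (hpG t ht) hne (hpne t ht) hiso (hpiso t ht)
  have hpp : ∀ t ∈ D, p (p t) = t := fun t ht =>
    (hp_uniq (p t) (hpD t ht) t (hDG t ht) (hpne t ht).symm (hIso_symm _ _ (hpiso t ht))).symm
  -- orientation of the pairs by an enumeration of `G`
  let rk : I → ℕ := fun t => if h : t ∈ G then (G.equivFin ⟨t, h⟩ : ℕ) else 0
  have hrk : ∀ a ∈ G, ∀ b ∈ G, rk a = rk b → a = b := fun a ha b hb h => by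
    simp only [rk, dif_pos ha, dif_pos hb] at h
    exact Subtype.ext_iff.1 (G.equivFin.injective (Fin.ext h))
  let U : Finset I := D.filter fun t => rk t < rk (p t)
  let Sg : Finset I := G.filter fun t => t ∉ D
  let u : Fin U.card → I := fun j => (U.equivFin.symm j).1
  let e : Fin Sg.card → I := fun m => (Sg.equivFin.symm m).1
  have hu_mem : ∀ j, u j ∈ D ∧ rk (u j) < rk (p (u j)) := fun j => Finset.mem_filter.1 (U.equivFin.symm j).2
  have hu_inj : Function.Injective u := fun j j' h => U.equivFin.symm.injective (Subtype.ext h)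
  have hu_surj : ∀ t ∈ D, rk t < rk (p t) → ∃ j, t = u j := fun t ht hlt =>
    ⟨U.equivFin ⟨t, Finset.mem_filter.2 ⟨ht, hlt⟩⟩, by simp only [u, Equiv.symm_apply_apply]⟩
  have he_mem : ∀ m, e m ∈ G ∧ e m ∉ D := fun m => Finset.mem_filter.1 (Sg.equivFin.symm m).2
  have he_inj : Function.Injective e := fun m m' h => Sg.equivFin.symm.injective (Subtype.ext h)
  have he_surj : ∀ t ∈ G, t ∉ D → ∃ m, t = e m := fun t ht hD =>
    ⟨Sg.equivFin ⟨t, Finset.mem_filter.2 ⟨ht, hD⟩⟩, by simp only [e, Equiv.symm_apply_apply]⟩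
  have hD_cases : ∀ t ∈ D, (∃ j, t = u j) ∨ ∃ j, t = p (u j) := fun t ht => by
    by_cases hlt : rk t < rk (p t)
    · exact Or.inl (hu_surj t ht hlt)
    · have hlt' : rk (p t) < rk (p (p t)) := by
        rw [hpp t ht]
        exact lt_of_le_of_ne (not_lt.1 hlt) fun h => hpne t ht (hrk _ (hpG t ht) _ (hDG t ht) h)
      obtain ⟨j, hj⟩ := hu_surj (p t) (hpD t ht) hlt'
      exact Or.inr ⟨j, by rw [← hj, hpp t ht]⟩
  -- the data of §1
  have hisoU : ∀ j₀ j : Fin U.card, j₀ ≠ j → IsEmpty (K (u j) →+* K (u j₀)) := fun j₀ j hne =>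
    ⟨fun g => by
      have h := hp_uniq (u j₀) (hu_mem j₀).1 (u j) (hDG _ (hu_mem j).1) (fun h => hne (hu_inj h).symm) (hIso_of_hom _ (hDG _ (hu_mem j₀).1) _ (hDG _ (hu_mem j).1) g)
      have h' : p (u j) = u j₀ := by rw [h, hpp _ (hu_mem j₀).1]
      have h₁ := (hu_mem j).2
      have h₂ := (hu_mem j₀).2
      rw [h'] at h₁
      rw [← h] at h₂
      exact lt_asymm h₁ h₂⟩
  have hisoUE : ∀ (j : Fin U.card) (m : Fin Sg.card), IsEmpty (K (e m) →+* K (u j)) := fun j m =>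
    ⟨fun g => (he_mem m).2 ((hDmem _).2 ⟨(he_mem m).1, u j, hDG _ (hu_mem j).1, fun h => (he_mem m).2 (h ▸ (hu_mem j).1),
      hIso_symm _ _ (hIso_of_hom _ (hDG _ (hu_mem j).1) _ (he_mem m).1 g)⟩)⟩
  have hiso : ∀ m₀ m : Fin Sg.card, m₀ ≠ m → IsEmpty (K (e m) →+* K (e m₀)) := fun m₀ m hne =>
    ⟨fun g => (he_mem m).2 ((hDmem _).2 ⟨(he_mem m).1, e m₀, (he_mem m₀).1, fun h => hne (he_inj h),
      hIso_symm _ _ (hIso_of_hom _ (he_mem m₀).1 _ (he_mem m).1 g)⟩)⟩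
  refine hodgeConjectureFor_prod_twinPairsGroupBlock_of_isEmpty_ringHom hW4 hA hS u (fun j => p (u j)) (fun j => h6 _ (hDG _ (hu_mem j).1))
    (fun j => Classical.choice (hpiso _ (hu_mem j).1)) (fun j => hN _ (hDG _ (hu_mem j).1) _ (hpG _ (hu_mem j).1) (hpne _ (hu_mem j).1).symm) e
    (fun m => h6 _ (he_mem m).1) h2 (fun j => Classical.choice (iG _ (hDG _ (hu_mem j).1))) (fun m => Classical.choice (iG _ (he_mem m).1)) hisoU hisoUE hiso ρ
    fun l => ?_
  rcases hρ l with ⟨h2l, t, ht, ⟨g⟩⟩ | hl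
  · refine Or.inl ⟨h2l, ?_⟩
    by_cases htD : t ∈ D
    · rcases hD_cases t htD with ⟨j, rfl⟩ | ⟨j, rfl⟩
      · exact Or.inl ⟨j, ⟨g⟩⟩
      · exact Or.inl ⟨j, ⟨(Classical.choice (hpiso _ (hu_mem j).1)).toRingHom.comp g⟩⟩
    · obtain ⟨m, rfl⟩ := he_surj t ht htD
      exact Or.inr ⟨m, ⟨g⟩⟩
  · by_cases hlD : ρ l ∈ D
    · rcases hD_cases (ρ l) hlD with ⟨j, hj⟩ | ⟨j, hj⟩
      · exact Or.inr (Or.inl ⟨j, hj⟩)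
      · exact Or.inr (Or.inr (Or.inl ⟨j, hj⟩))
    · exact Or.inr (Or.inr (Or.inr (he_surj (ρ l) hl hlD)))

/-- **Dominated form of the relational twin-pairs group block.** [cite: Markman2025SurveySecant, Thm. 1.2] [cite: MumfordAV1970, §19 Thm. 1 and p. 169] -/
theorem hodgeConjectureFor_of_avDominatedBy_prod_twinPairsGroupBlock_of_card_le_two (hW4 : Markman2025_weilClasses_algebraic_abelianFourfold)
    (hA : ∀ i, IsCMTypeRealisation (Φ i) (A i) (ι i) (θ i)) (hS : ∀ i, (A i).IsSimple)
    (G : Finset I) (h6 : ∀ t ∈ G, Module.finrank ℚ (K t) = 6)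
    {k : Type} [Field k] [NumberField k] [IsCMField k] (h2 : Module.finrank ℚ k = 2) (iG : ∀ t ∈ G, Nonempty (k →+* K t))
    (h2G : ∀ t ∈ G, (G.filter fun t' => Nonempty (K t' ≃+* K t)).card ≤ 2)
    (hN : ∀ t ∈ G, ∀ t' ∈ G, t ≠ t' → ¬ AbelianVariety.IsIsogenous (A t) (A t'))
    {M : ℕ} (ρ : Fin M → I) (hρ : ∀ l, (Module.finrank ℚ (K (ρ l)) = 2 ∧ ∃ t ∈ G, Nonempty (K (ρ l) →+* K t)) ∨ ρ l ∈ G)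
    {X : AbelianVariety ℂ} (hX : Domination.AVDominatedBy X (⨁ fun l => A (ρ l))) : HodgeConjectureFor X.dim X.X :=
  Domination.hodgeConjectureFor_of_avDominatedBy (hodgeConjectureFor_prod_twinPairsGroupBlock_of_card_le_two hW4 hA hS G h6 h2 iG h2G hN ρ hρ) hX

end TwinPairsGroup

end Summit.HodgeConjecture.CorCM.MultiFieldWeil

end
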